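import Literature.AlgebraicGeometry.ModuliOfAbelianVarieties.SiegelModuliInterpretation
import Literature.AlgebraicGeometry.ModuliOfAbelianVarieties.SiegelSpaceComplexStructures
import Literature.AlgebraicGeometry.AbelianVarieties.PolarisedTorusProjective
import HarnessLib

/-!
# Every point `[J, a]` of the Siegel double coset MARKS an abelian variety: non-vacuity of `SiegelAdelicMarking`
# (Lange 2023 Lemma 7.1.5 + Lefschetz–Chow–GAGA) — theorems-only sibling of `SiegelModuliInterpretation`

Topic `AlgebraicGeometry/ModuliOfAbelianVarieties`; namespace `Literature.AlgebraicGeometry.ModuliOfAbelianVarieties`.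
Cell hodgecm-mathlib, #60 Mumford line, T1′ package (B-typ04 g7): THEOREMS ONLY (0 def / 0 fact / 0 instance / 0 sorry).
For every `J ∈ S^±` (★ `C0pm δ`), every `a ∈ GSp_δ(𝔸_f)` and every rational basis matrix `γ` of `Λ_a = ℚ^{2g} ∩ a ẑ^{2g}`
(`IsLatticeBasis a γ`), the polarised complex torus `(V_ℝ, J)/γℤ^{2g}` — complex structure `J`, Riemann form `± N·ψ_δ`
(`N` clearing the denominators of `γᵀ E_δ γ`, the sign that of the half of `S^±`) — is an abelian variety by ★
`SiegelModuli.C0`/Lange (2023) Lemma 7.1.5 in the ★ `ComplexTorus.IsAbelianVariety` currency, hence (Lefschetz–Chow–GAGA, ★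
`AbelianVarieties.exists_abelianVariety_of_isAbelianVariety`) analytified by an `AbelianVariety ℂ`; this inhabits
`SiegelAdelicMarking J a A` (`SiegelAdelicMarking.exists`).  It is the `build` input of M3 (`IsModuli R → IsCanonical R`,
[Milne2005ShimuraVarieties] Prop. 14.12) and the non-vacuity certificate of the T1′ carrier (REF1 registration test (ii)).
Homomorphisms OUT OF / INTO / BETWEEN marked abelian varieties (torus maps descend, GAGA) are B-p01's sequel
`SiegelAdelicMarkingHoms.lean` (one writer per lemma); this file is the non-vacuity certificate only.

## References
* [Lange2023AbelianVarietiesComplex] H. Lange, *Abelian Varieties over the Complex Numbers* (2023), §7.1.2 Lemma 7.1.5.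
* [LangeBirkenhake1992] H. Lange, Ch. Birkenhake, *Complex Abelian Varieties* (1992), §4.1, Thm. 4.2.1.
* [Milne2005ShimuraVarieties] J. S. Milne, *Introduction to Shimura varieties*, §6 Thm. 6.7 p. 72, Thm. 6.11 p. 74.
-/

noncomputable section

open Matrix NumberField IsDedekindDomain CategoryTheory
open Literature.Geometry.Kaehler (ComplexTorus)
open Literature.NumberTheory.Transcendental (IsAnalytification)

namespace Literature.AlgebraicGeometry.ModuliOfAbelianVarieties

open Literature.AlgebraicGeometry.Motives (AbelianVariety ComplexPoints AlgPoints)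

variable {g : ℕ} {δ : Fin g → ℕ}

/-! ### The polarised torus of a point and its algebraisation -/

section Build

open Module
open Literature.Geometry.Kaehler
open Literature.AlgebraicGeometry.AbelianVarieties (exists_abelianVariety_of_isAbelianVariety)
open SiegelModuli (realTypeForm C0 mem_C0_iff formBilin formBilin_apply formBilin_self formBilin_mulVec_left
  realTypeForm_eq_map_typeForm)

variable (J : C0pm δ) (a : gspFinAdelic δ)

/-- `dim_ℝ ℝ^{2g} = 2g`. [folklore] -/
private theorem finrank_fin_sum' (g : ℕ) : Module.finrank ℝ (Fin g ⊕ Fin g → ℝ) = 2 * g := by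
  rw [Module.finrank_fintype_fun_eq_card, Fintype.card_sum, Fintype.card_fin]; ring

/-- `J² = -1` as linear maps. [folklore] -/
private theorem toLin'_mul_toLin'_of_mul_self' {M : Matrix (Fin g ⊕ Fin g) (Fin g ⊕ Fin g) ℝ} (hM : M * M = -1) :
    Matrix.toLin' M * Matrix.toLin' M = -1 := by
  change (Matrix.toLin' M).comp (Matrix.toLin' M) = -1
  rw [← Matrix.toLin'_mul, hM, map_neg, Matrix.toLin'_one]
  rfl

/-- `γ_ℝ · (γ⁻¹)_ℝ = 1`. [folklore] -/
private theorem map_mul_map_inv (γ : GL (Fin g ⊕ Fin g) ℚ) : (((γ : GL (Fin g ⊕ Fin g) ℚ) : Matrix (Fin g ⊕ Fin g) (Fin g ⊕ Fin g) ℚ).map (algebraMap ℚ ℝ)) * (((γ⁻¹ : GL (Fin g ⊕ Fin g) ℚ) : Matrix (Fin g ⊕ Fin g) (Fin g ⊕ Fin g) ℚ).map (algebraMap ℚ ℝ)) = 1 := by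
  rw [← Matrix.map_mul, ← Units.val_mul, mul_inv_cancel, Units.val_one, Matrix.map_one _ (map_zero _) (map_one _)]

/-- `(γ⁻¹)_ℝ · γ_ℝ = 1`. [folklore] -/
private theorem map_inv_mul_map (γ : GL (Fin g ⊕ Fin g) ℚ) : (((γ⁻¹ : GL (Fin g ⊕ Fin g) ℚ) : Matrix (Fin g ⊕ Fin g) (Fin g ⊕ Fin g) ℚ).map (algebraMap ℚ ℝ)) * (((γ : GL (Fin g ⊕ Fin g) ℚ) : Matrix (Fin g ⊕ Fin g) (Fin g ⊕ Fin g) ℚ).map (algebraMap ℚ ℝ)) = 1 := by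
  rw [← Matrix.map_mul, ← Units.val_mul, inv_mul_cancel, Units.val_one, Matrix.map_one _ (map_zero _) (map_one _)]

/-- The real-linear automorphism `y ↦ γ y` of `ℝ^{2g}` exists (stated as `∃`, this file being theorems-only). [folklore] -/
private theorem exists_linearEquiv_apply_eq_mulVec (γ : GL (Fin g ⊕ Fin g) ℚ) :
    ∃ e : (Fin g ⊕ Fin g → ℝ) ≃ₗ[ℝ] (Fin g ⊕ Fin g → ℝ), ∀ y, e y = (((γ : GL (Fin g ⊕ Fin g) ℚ) : Matrix (Fin g ⊕ Fin g) (Fin g ⊕ Fin g) ℚ).map (algebraMap ℚ ℝ)) *ᵥ y :=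
  ⟨LinearEquiv.ofLinear (Matrix.toLin' (((γ : GL (Fin g ⊕ Fin g) ℚ) : Matrix (Fin g ⊕ Fin g) (Fin g ⊕ Fin g) ℚ).map (algebraMap ℚ ℝ))) (Matrix.toLin' (((γ⁻¹ : GL (Fin g ⊕ Fin g) ℚ) : Matrix (Fin g ⊕ Fin g) (Fin g ⊕ Fin g) ℚ).map (algebraMap ℚ ℝ)))
      (by rw [← Matrix.toLin'_mul, map_mul_map_inv, Matrix.toLin'_one])
      (by rw [← Matrix.toLin'_mul, map_inv_mul_map, Matrix.toLin'_one]),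
    fun y => Matrix.toLin'_apply _ _⟩

/-- A common denominator for finitely many rationals. [folklore] -/
private theorem exists_nat_mul_int {ι : Type} [Fintype ι] (q : ι → ℚ) :
    ∃ N : ℕ, 0 < N ∧ ∀ i, ∃ k : ℤ, (N : ℚ) * q i = k := by
  classical
  refine ⟨∏ i, (q i).den, Finset.prod_pos fun i _ => (q i).den_pos, fun i => ?_⟩
  rw [← Finset.mul_prod_erase Finset.univ (fun j => (q j).den) (Finset.mem_univ i)]
  refine ⟨(∏ j ∈ Finset.univ.erase i, ((q j).den : ℤ)) * (q i).num, ?_⟩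
  push_cast
  rw [mul_comm ((q i).den : ℚ), mul_assoc, mul_comm ((q i).den : ℚ), Rat.mul_den_eq_num]

/-- `(col i of M) ⬝ᵥ E (col j of M) = (Mᵀ E M)ᵢⱼ`. [folklore] -/
private theorem col_dotProduct_mulVec_col {n : Type} [Fintype n] (M E : Matrix n n ℝ) (i j : n) :
    M.col i ⬝ᵥ (E *ᵥ M.col j) = (Mᵀ * E * M) i j := by
  rw [Matrix.mul_assoc, Matrix.mul_apply, dotProduct]
  refine Finset.sum_congr rfl fun k _ => ?_
  rw [Matrix.transpose_apply, Matrix.col_apply, Matrix.mulVec, dotProduct, Matrix.mul_apply]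
  rfl

/-- `γ_ℝᵀ E_δ γ_ℝ` is the rational matrix `γᵀ E_δ γ` read in `ℝ`. [folklore] -/
private theorem transpose_map_mul_realTypeForm_mul_map (γ : GL (Fin g ⊕ Fin g) ℚ) :
    (((γ : GL (Fin g ⊕ Fin g) ℚ) : Matrix (Fin g ⊕ Fin g) (Fin g ⊕ Fin g) ℚ).map (algebraMap ℚ ℝ))ᵀ * realTypeForm δ * (((γ : GL (Fin g ⊕ Fin g) ℚ) : Matrix (Fin g ⊕ Fin g) (Fin g ⊕ Fin g) ℚ).map (algebraMap ℚ ℝ)) =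
      ((((γ : GL (Fin g ⊕ Fin g) ℚ) : Matrix _ _ ℚ)ᵀ * (typeForm δ).map (Int.cast : ℤ → ℚ) *
        ((γ : GL (Fin g ⊕ Fin g) ℚ) : Matrix _ _ ℚ)).map (algebraMap ℚ ℝ)) := by
  have hE : realTypeForm δ = ((typeForm δ).map (Int.cast : ℤ → ℚ)).map (algebraMap ℚ ℝ) := by
    rw [realTypeForm_eq_map_typeForm, Matrix.map_map]
    congr 1
  rw [Matrix.map_mul, Matrix.map_mul, ← hE, Matrix.transpose_map]

/-- `J ∈ S^±` squares to `-1`. [cite: Lange2023AbelianVarietiesComplex, §7.1.2 (7.1)] -/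
private theorem mul_self_of_mem_C0pm {Jm : Matrix (Fin g ⊕ Fin g) (Fin g ⊕ Fin g) ℝ} (h : Jm ∈ C0pm δ) :
    Jm * Jm = -1 := by
  rcases h with h | h
  · exact h.1.mul_self
  · have := h.1.mul_self; rwa [neg_mul_neg] at this

/-- `J ∈ S^±` is symplectic. [cite: Lange2023AbelianVarietiesComplex, §7.1.2 (7.1)] -/
private theorem transpose_mul_mul_of_mem_C0pm {Jm : Matrix (Fin g ⊕ Fin g) (Fin g ⊕ Fin g) ℝ} (h : Jm ∈ C0pm δ) :
    Jmᵀ * realTypeForm δ * Jm = realTypeForm δ := by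
  rcases h with h | h
  · exact h.1.transpose_mul_mul
  · have := h.1.transpose_mul_mul; rwa [transpose_neg, neg_mul, neg_mul_neg] at this

/-- `J ∈ S^±`: `± ᵗJ E_δ` is positive definite, read as «`ε · ᵗx ᵗJ E_δ x > 0` for a sign `ε = ±1`».
[cite: Lange2023AbelianVarietiesComplex, §7.1.2 (7.1)] [cite: Milne2005ShimuraVarieties, §6 pp. 68–70] -/
private theorem exists_sign_of_mem_C0pm {Jm : Matrix (Fin g ⊕ Fin g) (Fin g ⊕ Fin g) ℝ} (h : Jm ∈ C0pm δ) :
    ∃ ε : ℤ, (ε = 1 ∨ ε = -1) ∧ ∀ x : Fin g ⊕ Fin g → ℝ, x ≠ 0 → 0 < (ε : ℝ) * (x ⬝ᵥ (Jmᵀ * realTypeForm δ) *ᵥ x) := by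
  rcases h with h | h
  · refine ⟨1, Or.inl rfl, fun x hx => ?_⟩
    rw [Int.cast_one, one_mul]
    simpa only [star_trivial] using h.2.dotProduct_mulVec_pos hx
  · refine ⟨-1, Or.inr rfl, fun x hx => ?_⟩
    have h' := h.2.dotProduct_mulVec_pos hx
    simp only [star_trivial, transpose_neg, neg_mul, neg_mulVec, dotProduct_neg] at h'
    rw [Int.cast_neg, Int.cast_one, neg_one_mul]
    exact h'

/-- **NON-VACUITY of `SiegelAdelicMarking`**: for every `J ∈ S^±` (★ `C0pm δ`, either half), every `a ∈ GSp_δ(𝔸_f)` and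
every basis matrix `γ` of `Λ_a`, the polarised torus `(V_ℝ, J)/γℤ^{2g}` (Riemann form `± N ψ_δ`) is (analytified by) an
abelian variety `A/ℂ` marked by `[J, a]`.  Lange (2023) Lemma 7.1.5 (★ `IsAbelianVariety` currency) + Lefschetz–Chow–GAGA
(★ `exists_abelianVariety_of_isAbelianVariety`).  This is the `build` input of M3 and REF1's registration test (ii)
(non-vacuity at ANY lattice, in particular a non-maximal order at `g = 1`).
[cite: Lange2023AbelianVarietiesComplex, §7.1.2 Lemma 7.1.5] [cite: LangeBirkenhake1992, §4.1 and Thm. 4.2.1]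
[cite: Milne2005ShimuraVarieties, §6 Thm. 6.11 p. 74] -/
theorem SiegelAdelicMarking.exists (γ : GL (Fin g ⊕ Fin g) ℚ) (hγ : IsLatticeBasis a γ) :
    ∃ A : AbelianVariety ℂ, Nonempty (SiegelAdelicMarking J a A) := by
  classical
  -- the complex structure `J` on `W = ℝ^{2g}` and the lattice basis `bᵢ = γ eᵢ`
  set Jm : Matrix (Fin g ⊕ Fin g) (Fin g ⊕ Fin g) ℝ := (J : Matrix (Fin g ⊕ Fin g) (Fin g ⊕ Fin g) ℝ) with hJm
  have hJpm : Jm ∈ C0pm δ := J.2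
  have hJJ : Matrix.toLin' Jm * Matrix.toLin' Jm = -1 := toLin'_mul_toLin'_of_mul_self' (mul_self_of_mem_C0pm hJpm)
  obtain ⟨eγ, heγ⟩ := exists_linearEquiv_apply_eq_mulVec γ
  let b : Basis (Fin g ⊕ Fin g) ℝ (Fin g ⊕ Fin g → ℝ) := Basis.ofEquivFun eγ.symm
  have hb : ∀ y, b.equivFun.symm y = (((γ : GL (Fin g ⊕ Fin g) ℚ) : Matrix (Fin g ⊕ Fin g) (Fin g ⊕ Fin g) ℚ).map (algebraMap ℚ ℝ)) *ᵥ y := fun y => by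
    change (Basis.ofEquivFun eγ.symm).equivFun.symm y = _
    rw [Basis.equivFun_ofEquivFun, LinearEquiv.symm_symm, heγ]
  have hbi : ∀ i, b i = (((γ : GL (Fin g ⊕ Fin g) ℚ) : Matrix (Fin g ⊕ Fin g) (Fin g ⊕ Fin g) ℚ).map (algebraMap ℚ ℝ)).col i := fun i => by
    rw [← CxModule.basis_equivFun_symm_single b i, hb, mulVec_single_one]
  -- the period isomorphism `Ψ y = coordJ (γ y)`
  let Ψ : (Fin g ⊕ Fin g → ℝ) ≃L[ℝ] (Fin g → ℂ) :=
    CxModule.periodIso (Matrix.toLin' Jm) hJJ (finrank_fin_sum' g) b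
  have hΨ : ∀ y, Ψ y = CxModule.coordJ (Matrix.toLin' Jm) hJJ (finrank_fin_sum' g) ((((γ : GL (Fin g ⊕ Fin g) ℚ) : Matrix (Fin g ⊕ Fin g) (Fin g ⊕ Fin g) ℚ).map (algebraMap ℚ ℝ)) *ᵥ y) :=
    fun y => by
    change CxModule.periodIso _ hJJ (finrank_fin_sum' g) b y = _
    rw [CxModule.periodIso_apply, hb]
  -- the Riemann form `ε N · ψ_δ`: `ε` the sign of the half, `N` clearing the denominators of `γᵀ E_δ γ`
  set Mq : Matrix (Fin g ⊕ Fin g) (Fin g ⊕ Fin g) ℚ :=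
    (((γ : GL (Fin g ⊕ Fin g) ℚ) : Matrix _ _ ℚ)ᵀ * (typeForm δ).map (Int.cast : ℤ → ℚ) *
      ((γ : GL (Fin g ⊕ Fin g) ℚ) : Matrix _ _ ℚ)) with hMq
  obtain ⟨N, hN, hNint⟩ := exists_nat_mul_int (fun ij : (Fin g ⊕ Fin g) × (Fin g ⊕ Fin g) => Mq ij.1 ij.2)
  obtain ⟨ε, -, hpos⟩ := exists_sign_of_mem_C0pm hJpm
  have hX : ComplexTorus.IsAbelianVariety Ψ := by
    refine CxModule.isAbelianVariety_periodIso (Matrix.toLin' Jm) hJJ (finrank_fin_sum' g) b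
      (((ε : ℝ) * N) • formBilin δ) (fun x => ?_) (fun x y => ?_) (fun i j => ?_) (fun x hx => ?_)
    · rw [LinearMap.smul_apply, LinearMap.smul_apply, formBilin_self, smul_zero]
    · rw [LinearMap.smul_apply, LinearMap.smul_apply, LinearMap.smul_apply, LinearMap.smul_apply,
        Matrix.toLin'_apply, Matrix.toLin'_apply, formBilin_mulVec_left, mulVec_mulVec, transpose_mul_mul_of_mem_C0pm hJpm,
        formBilin_apply]
    · obtain ⟨k, hk⟩ := hNint (i, j)
      refine ⟨ε * k, ?_⟩
      rw [LinearMap.smul_apply, LinearMap.smul_apply, hbi, hbi, formBilin_apply, smul_eq_mul,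
        col_dotProduct_mulVec_col, transpose_map_mul_realTypeForm_mul_map, ← hMq, Matrix.map_apply,
        eq_ratCast, ← Rat.cast_natCast, mul_assoc, ← Rat.cast_mul, hk, Rat.cast_intCast, Int.cast_mul]
    · rw [LinearMap.smul_apply, LinearMap.smul_apply, Matrix.toLin'_apply, formBilin_mulVec_left, smul_eq_mul,
        mul_comm (ε : ℝ), mul_assoc]
      exact mul_pos (by exact_mod_cast hN) (hpos x hx)
  -- algebraise
  obtain ⟨A, φA, hdim, hφ, -, hadd, -, -⟩ := exists_abelianVariety_of_isAbelianVariety Ψ hX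
  have hγγ : ∀ z : Fin g ⊕ Fin g → ℝ, (((γ : GL (Fin g ⊕ Fin g) ℚ) : Matrix (Fin g ⊕ Fin g) (Fin g ⊕ Fin g) ℚ).map (algebraMap ℚ ℝ)) *ᵥ ((((γ⁻¹ : GL (Fin g ⊕ Fin g) ℚ) : Matrix (Fin g ⊕ Fin g) (Fin g ⊕ Fin g) ℚ).map (algebraMap ℚ ℝ)) *ᵥ z) = z := fun z => by
    rw [mulVec_mulVec, map_mul_map_inv, one_mulVec]
  have hφ' : IsAnalytification (Fin g → ℂ) A.X A.dim φA := by rw [hdim]; exact hφ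
  refine ⟨A, ⟨⟨γ, hγ, Ψ, fun x => ?_, φA, hφ', hadd⟩⟩⟩
  -- `Ψ (γ⁻¹ J x) = coordJ (J x) = i · coordJ x = i · Ψ (γ⁻¹ x)`
  change Ψ ((((γ⁻¹ : GL (Fin g ⊕ Fin g) ℚ) : Matrix (Fin g ⊕ Fin g) (Fin g ⊕ Fin g) ℚ).map (algebraMap ℚ ℝ)) *ᵥ (Jm *ᵥ x)) = Complex.I • Ψ ((((γ⁻¹ : GL (Fin g ⊕ Fin g) ℚ) : Matrix (Fin g ⊕ Fin g) (Fin g ⊕ Fin g) ℚ).map (algebraMap ℚ ℝ)) *ᵥ x)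
  rw [hΨ, hΨ, hγγ, hγγ, ← Matrix.toLin'_apply Jm x, CxModule.coordJ_J]

end Build

end Literature.AlgebraicGeometry.ModuliOfAbelianVarieties

end
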